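import Summits.NavierStokesRegularity.NavierStokesRegularity.Theorems.LerayQuarterDissipationFiniteDissipationLiouvilleTraceUniform
import HarnessLib

/-!
# Crux `FiniteDissipationLiouville` (stmt-NavierStokesRegularity-22144): continuity of the trace at the
# apex along pointwise limits in the stratum

Theorems file of route `LerayQuarterDissipation` (lead prover g3; `--supports` the crux). Navier–Stokes
regularity is NOT proved by anything here; no summit is.

`tendsto_trace_of_tendsto_slices`: if members `w_j ∈ 𝒟_{C,K}` converge pointwise on the open past to a
member `W ∈ 𝒟_{C,K}` (the convergence produced by `RecurrentReductionD.orbitLimit` /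
`persistent_singularity`), then their trace values against a test field `φ` converge to that of `W`
(`ε/3`: the UNIFORM rate `|∫⟪u(t),φ⟫ − L| ≤ M(−t)^{1/4}` of `…TraceUniform`, and dominated convergence on
one slice). Hence the traces of the scaling hull of a singular member of the stratum form a compact,
dilation-invariant family of nonzero distributions — the object on which
`stub_pastWanderingRecurrentLiouville` (skeleton v5) is a rigidity statement.

References: Koch–Nadirashvili–Seregin–Šverák, Acta Math. 203 (2009), §4; D. Chae, J. Wolf,
arXiv:1610.09464, §2 Step 2.
-/

noncomputable section

-- the summit and its single sub-problem share the name (CONVENTIONS §1), as in every Theorems file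
set_option linter.dupNamespace false

namespace Summit.NavierStokesRegularity.NavierStokesRegularity.Theorems.FiniteDissipationLiouville.Birth.Apex

open MeasureTheory Set Filter Topology Metric Function TopologicalSpace
open Literature.Analysis Literature.Analysis.FluidPDE
open scoped ENNReal NNReal RealInnerProductSpace

/-! ### Continuity of the trace along pointwise limits in the stratum -/

/-- **The trace is continuous along pointwise limits in `𝒟_{C,K}`.** Let `w_j, W ∈ 𝒟_{C,K}` with
`w_j(t, x) → W(t, x)` for every `t < 0` and `x` (the convergence produced by
`RecurrentReductionD.orbitLimit`), and let `L_j`, `L` be their trace values against a test field `φ`.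
Then `L_j → L`. -/
theorem tendsto_trace_of_tendsto_slices {C K : ℝ}
    {φ : EuclideanSpace ℝ (Fin 3) → EuclideanSpace ℝ (Fin 3)}
    (hφ : FunctionSpaces.IsTestFunctionOn (⊤ : Opens (EuclideanSpace ℝ (Fin 3))) φ)
    {w : ℕ → ℝ → EuclideanSpace ℝ (Fin 3) → EuclideanSpace ℝ (Fin 3)}
    {W : ℝ → EuclideanSpace ℝ (Fin 3) → EuclideanSpace ℝ (Fin 3)}
    (hw : ∀ j, IsTypeIAncientMild C (w j))
    (hlaww : ∀ j, ∀ s : ℝ, s < 0 →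
      ∫⁻ x, ‖fderiv ℝ (w j s) x‖ₑ ^ 2 ≤ ENNReal.ofReal (K / Real.sqrt (-s)))
    (hW : IsTypeIAncientMild C W)
    (hlawW : ∀ s : ℝ, s < 0 → ∫⁻ x, ‖fderiv ℝ (W s) x‖ₑ ^ 2 ≤ ENNReal.ofReal (K / Real.sqrt (-s)))
    (hpt : ∀ t < 0, ∀ x, Tendsto (fun j => w j t x) atTop (𝓝 (W t x)))
    {Lw : ℕ → ℝ} {L : ℝ}
    (hLw : ∀ j, Tendsto (fun t => ∫ x, ⟪w j t x, φ x⟫) (𝓝[<] 0) (𝓝 (Lw j)))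
    (hL : Tendsto (fun t => ∫ x, ⟪W t x, φ x⟫) (𝓝[<] 0) (𝓝 L)) :
    Tendsto Lw atTop (𝓝 L) := by
  obtain ⟨M, hM⟩ := exists_trace_rate_unif C K hφ
  obtain ⟨K₀, -, -, hK₀, -, -⟩ := exists_bounds_of_isTestFunctionOn hφ
  rw [Metric.tendsto_atTop]
  intro ε hε
  -- a time near the apex where the uniform rate is below `ε/3`
  have hM0 : 0 ≤ M := by
    have h := hM W hW hlawW L hL (-(1 / 2)) ⟨by norm_num, by norm_num⟩
    have h1 : 0 < (-(-(1 / 2 : ℝ))) ^ (1 / 4 : ℝ) := Real.rpow_pos_of_pos (by norm_num) _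
    nlinarith [abs_nonneg ((∫ x, ⟪W (-(1 / 2)) x, φ x⟫) - L)]
  obtain ⟨t, ht, hrate⟩ : ∃ t ∈ Ioo (-1 : ℝ) 0, M * (-t) ^ (1 / 4 : ℝ) < ε / 3 := by
    set δ : ℝ := min (1 / 2) ((ε / (3 * (M + 1))) ^ (4 : ℝ)) with hδ
    have hδ0 : 0 < δ := lt_min (by norm_num) (Real.rpow_pos_of_pos (by positivity) _)
    have hδ1 : δ ≤ 1 / 2 := min_le_left _ _
    refine ⟨-δ, ⟨by linarith, by linarith⟩, ?_⟩
    rw [neg_neg]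
    have h1 : δ ^ (1 / 4 : ℝ) ≤ ((ε / (3 * (M + 1))) ^ (4 : ℝ)) ^ (1 / 4 : ℝ) :=
      Real.rpow_le_rpow hδ0.le (min_le_right _ _) (by norm_num)
    rw [← Real.rpow_mul (by positivity), show (4 : ℝ) * (1 / 4) = 1 by norm_num, Real.rpow_one] at h1
    have h2 : M * δ ^ (1 / 4 : ℝ) ≤ M * (ε / (3 * (M + 1))) := mul_le_mul_of_nonneg_left h1 hM0
    have h3 : M * (ε / (3 * (M + 1))) < ε / 3 := by
      rw [mul_div_assoc', div_lt_div_iff₀ (by positivity) (by norm_num)]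
      nlinarith
    exact h2.trans_lt h3
  -- the pairings at time `t` converge (dominated convergence on the support of `φ`)
  have ht0 : t < 0 := ht.2
  have hconv : Tendsto (fun j => ∫ x, ⟪w j t x, φ x⟫) atTop (𝓝 (∫ x, ⟪W t x, φ x⟫)) := by
    refine tendsto_integral_of_dominated_convergence (fun x => C / Real.sqrt (-t) * ‖φ x‖)
      (fun j => ?_) ?_ ?_ ?_
    · exact (((hw j).continuous_slice ht0).inner hφ.contDiff.continuous).aestronglyMeasurable
    · exact ((hφ.contDiff.continuous.norm).integrable_of_hasCompactSupport
        hφ.hasCompactSupport.norm).const_mul _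
    · intro j
      refine Eventually.of_forall fun x => ?_
      calc ‖⟪w j t x, φ x⟫‖ ≤ ‖w j t x‖ * ‖φ x‖ := norm_inner_le_norm _ _
        _ ≤ C / Real.sqrt (-t) * ‖φ x‖ :=
            mul_le_mul_of_nonneg_right ((hw j).norm_le ht0 x) (norm_nonneg _)
    · exact Eventually.of_forall fun x => ((hpt t ht0 x).inner tendsto_const_nhds)
  rw [Metric.tendsto_atTop] at hconv
  obtain ⟨N, hN⟩ := hconv (ε / 3) (by positivity)
  refine ⟨N, fun j hj => ?_⟩
  have h1 := hM (w j) (hw j) (hlaww j) (Lw j) (hLw j) t ht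
  have h2 := hM W hW hlawW L hL t ht
  have h3 := hN j hj
  rw [Real.dist_eq] at h3 ⊢
  have e : Lw j - L = (Lw j - ∫ x, ⟪w j t x, φ x⟫) + ((∫ x, ⟪w j t x, φ x⟫) - ∫ x, ⟪W t x, φ x⟫) +
      ((∫ x, ⟪W t x, φ x⟫) - L) := by ring
  rw [e]
  calc |(Lw j - ∫ x, ⟪w j t x, φ x⟫) + ((∫ x, ⟪w j t x, φ x⟫) - ∫ x, ⟪W t x, φ x⟫) +
        ((∫ x, ⟪W t x, φ x⟫) - L)|
      ≤ |Lw j - ∫ x, ⟪w j t x, φ x⟫| + |(∫ x, ⟪w j t x, φ x⟫) - ∫ x, ⟪W t x, φ x⟫| +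
        |(∫ x, ⟪W t x, φ x⟫) - L| := abs_add_three _ _ _
    _ < ε / 3 + ε / 3 + ε / 3 := by
        gcongr
        · rw [abs_sub_comm]; exact h1.trans_lt hrate
        · exact h2.trans_lt hrate
    _ = ε := by ring

end Summit.NavierStokesRegularity.NavierStokesRegularity.Theorems.FiniteDissipationLiouville.Birth.Apex

end
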